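import Summits.QuantumFields.YangMills.Theorems.BalabanUVNodesN15AtSpineCarriersBackground
import Summits.QuantumFields.YangMills.Theorems.BalabanUVNodesN15VectorPieceGaugeMatrix

/-!
# YM-DAG node N15 (= NE2) AT THE RATE CARRIERS OF RECORD, RE-KEYED WITH THE NON-ABELIAN BACKGROUND LIVE: the K4 stub `YMDAG.UVSplit.S_N15 RRec` closed over
# every rate-carrier predicate whose NE2 component carries one of the two realised NON-ABELIAN background families of the U = 1 vector piece ⊗ 1_𝔤 (matrix
# coefficient species ∕ `𝔄`-valued gauge field live) — the OPERATOR layer HYPOTHESIS-FREE by name ((3.35) consumed, size guard live), the site-kernel and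
# unit-lattice layers displayed

Track A of `YM-PLAN.md` (cell `pub-ymgap`, HUMAN RULING D-0062), node **N15**; typed by seat `pub-ymgap-dag-n15-c` (generation g2) as the spine-carrier faces of its
(N1)∕(N1′) chain (M1–M4, G1–G3).  Shape twin and import: this seat's (g0) `BalabanUVNodesN15AtSpineCarriersBackground` (p456241; same namespace, nothing restated —
its faces ∕ closers cover the three ABELIAN background families `bgVecInstance`, `bgVecInstance₁`, `gaugeVecInstance`).  Producers consumed BY NAME: this seat's M4
`VectorPiece.ne2PlusOperator_vectorPiece_backgroundM₁4` (non-abelian first-order species with abstract matrix coefficients, M3 instantiated) and G3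
`VectorPiece.ne2PlusOperator_vectorPiece_gaugeM4` (`𝔄`-valued gauge field live through `Phi1(η, ad_A)` in coordinates, G2 instantiated).  Kernel bookkeeping:
0 `def`, 0 `sorry`, standard axioms.  COUNT-NEUTRAL; `--supports` the K3 item `SpineGivenEndpointR11` (stmt-QuantumFields-19676).

THE STUB.  `S_N15 RRec := ∀ F D g₀ os R, RRec F D g₀ os R → N15At R.ne2`, `N15At c := NE2PlusOperator c.c35 c.pi c.Kop ∧ NE2PlusSite 4 c.p c.c35 c.pi c.Ksite ∧
NE2PlusUnit c.c35 c.pi c.Kunit c.inΛ c.unitDist`.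

WHAT THIS MODULE IS.
* §1 THE NODE FACES WITH THE NON-ABELIAN BACKGROUND LIVE: **`n15At_vectorPiece_backgroundM₁4_of_layers`** (matrix coefficient species, Lie-algebra index `ι`
  nonempty) and **`n15At_vectorPiece_gaugeM4_of_layers`** (`𝔄`-valued gauge field live, coordinates `e : 𝔄 ≃L[ℝ] ℝ^ι`) — for `d + 1 ≥ 2`, `L ≥ 1`, `c₃₅ > 0`, on the
  NE2 carriers indexed by the sized family `VecIndexS d L` whose paired instances ∕ operator kernels are the realised non-abelian families on the product carriers
  `X × ι`, `N15At` follows from the site-kernel and unit-lattice layers ALONE — the operator conjunct is the producer's theorem.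
* §2 (W2) CLOSERS, refinement-generic: **`s_N15_of_backgroundM₁4Reading`**, **`s_N15_of_gaugeM4Reading`**.
* §3 GUARD: `not_n15At_iff_site_or_unit_fails_gaugeM4` — on the gauge-live non-abelian carriers `N15At` FAILS iff the site OR the unit layer fails.

HONEST FRAMING.  NE2 is NOT PRINTED beyond King's scalar template and NOT PROVED for Bałaban's `G(U)`.  What enters hypothesis-free is the operator layer of the
LINEAR (U = 1) vector single-scale piece of [B5]∕[B6]∕King (4.42) tensored with `1_𝔤`, dressed by the NON-ABELIAN first-order species — abstract matrix coefficients
(M4) or coefficients derived from an `𝔄`-valued gauge field through the transporter species `η⁻¹(exp(η ad_A) − 1)` in coordinates (G3; `𝔤` modelled by a complete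
normed algebra with `ad` = commutator) — with linearised entrywise ∕ fibrewise-mean transport; NOT the (C3) nonlinear transport, NOT the second-order `F′_{1,k}`
term, NOT the multiscale carrier of NODE 00; the SITE-KERNEL and UNIT-LATTICE layers of `N15At` remain DISPLAYED (no producer with the background live exists in
the tree).  N15 is NOT discharged (0∕1 at every record); typed 28∕28, discharged count untouched; one finite four-torus programme at fixed `ε` — NOT ℝ⁴, NOT infinite
volume, NOT OS, NOT a mass gap, NOT Clay.  Restate-immune.  No decl below carries a cite tag.
-/

noncomputable section

open Finset

namespace Summit.QuantumFields.YangMills.Theorems.N15AtSpineCarriers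

open Literature.MathematicalPhysics.QuantumFieldTheory.Balaban1983to89
open Literature.MathematicalPhysics.QuantumFieldTheory.Balaban1983to89.T4Continuum
open Literature.MathematicalPhysics.QuantumFieldTheory.Balaban1983to89.B9 (SiteKernel)
open Literature.MathematicalPhysics.QuantumFieldTheory.Balaban1983to89.T4EtaRate (PairedInstance NE2PlusOperator NE2PlusSite NE2PlusUnit)
open Summit.QuantumFields.YangMills.BalabanUVNodes.N15.VectorPiece (VecIndexS bgVecInstanceM₁ bgVecFamilyM₁4 gaugeVecInstanceM gaugeVecFamilyM4
  ne2PlusOperator_vectorPiece_backgroundM₁4 ne2PlusOperator_vectorPiece_gaugeM4)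
open YMDAG.UVSplit (Datum NE2Carriers RateCarriers RateRecordPred N15At RatesAt S_N15)

variable {N : ℕ} [NeZero N] {d : ℕ} {L : ℕ} [NeZero L] {ι : Type} [Fintype ι] [DecidableEq ι]
  {𝔄 : Type} [NormedRing 𝔄] [NormedAlgebra ℝ 𝔄] [CompleteSpace 𝔄] (e : 𝔄 ≃L[ℝ] (ι → ℝ))

/-! ## §1 The node faces with the non-abelian background live: `N15At` from the site and unit layers alone -/

section Faces

/-- **`N15At` WITH THE NON-ABELIAN FIRST-ORDER SPECIES (MATRIX COEFFICIENTS) LIVE, FROM THE SITE AND UNIT LAYERS ALONE.**  On the NE2 carriers indexed by the sized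
family, with paired instances M4's `bgVecInstanceM₁` (matrix coefficient carriers = the (3.35) letter pair on every entry, guard = the index's `M`) and operator
kernels `bgVecFamilyM₁4` (M1∕M3's constructed non-abelian pair fed with the -a pieces ⊗ 1_𝔤), the operator conjunct is
`VectorPiece.ne2PlusOperator_vectorPiece_backgroundM₁4` (hypothesis-free for `d + 1 ≥ 2`, `L ≥ 1`, `c₃₅ > 0`, `ι` nonempty); `N15At` follows from the two displayed
layers. [bookkeeping] -/
theorem n15At_vectorPiece_backgroundM₁4_of_layers [Nonempty ι] (hd : 1 ≤ d) (hL : 1 ≤ L) {c35 : ℝ} (hc35 : 0 < c35) (p : ℝ)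
    (Ksite Kunit : ∀ j : VecIndexS d L, SiteKernel (bgVecInstanceM₁ (d := d) ι L hL j).gc (bgVecInstanceM₁ (d := d) ι L hL j).Bf)
    (inΛ : ∀ j : VecIndexS d L, (bgVecInstanceM₁ (d := d) ι L hL j).gc.Site → Prop)
    (unitDist : ∀ j : VecIndexS d L, (bgVecInstanceM₁ (d := d) ι L hL j).gc.Site → (bgVecInstanceM₁ (d := d) ι L hL j).gc.Site → ℝ)
    (hsite : NE2PlusSite 4 p c35 (bgVecInstanceM₁ (d := d) ι L hL) Ksite)
    (hunit : NE2PlusUnit c35 (bgVecInstanceM₁ (d := d) ι L hL) Kunit inΛ unitDist) :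
    N15At { I := VecIndexS d L, c35 := c35, p := p, pi := bgVecInstanceM₁ (d := d) ι L hL, Kop := bgVecFamilyM₁4 (d := d) ι L hL,
            Ksite := Ksite, Kunit := Kunit, inΛ := inΛ, unitDist := unitDist } :=
  ⟨ne2PlusOperator_vectorPiece_backgroundM₁4 (d := d) hd hL c35 hc35, hsite, hunit⟩

/-- **`N15At` WITH THE NON-ABELIAN (`𝔄`-VALUED) GAUGE FIELD LIVE, FROM THE SITE AND UNIT LAYERS ALONE.**  As above with G3's `gaugeVecInstanceM` ∕ `gaugeVecFamilyM4`
(configurations = gauge fields `A′ : Fin (d+1) → X′ → 𝔄`, (3.35) consumed on `A′` itself in the norm of `𝔄`, the perturbation's matrix coefficients derived from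
`A′` by `Phi1(η, ad_A)` in the coordinates `e`); the operator conjunct is `VectorPiece.ne2PlusOperator_vectorPiece_gaugeM4`. [bookkeeping] -/
theorem n15At_vectorPiece_gaugeM4_of_layers (hd : 1 ≤ d) (hL : 1 ≤ L) {c35 : ℝ} (hc35 : 0 < c35) (p : ℝ)
    (Ksite Kunit : ∀ j : VecIndexS d L, SiteKernel (gaugeVecInstanceM (d := d) 𝔄 ι L hL j).gc (gaugeVecInstanceM (d := d) 𝔄 ι L hL j).Bf)
    (inΛ : ∀ j : VecIndexS d L, (gaugeVecInstanceM (d := d) 𝔄 ι L hL j).gc.Site → Prop)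
    (unitDist : ∀ j : VecIndexS d L, (gaugeVecInstanceM (d := d) 𝔄 ι L hL j).gc.Site → (gaugeVecInstanceM (d := d) 𝔄 ι L hL j).gc.Site → ℝ)
    (hsite : NE2PlusSite 4 p c35 (gaugeVecInstanceM (d := d) 𝔄 ι L hL) Ksite)
    (hunit : NE2PlusUnit c35 (gaugeVecInstanceM (d := d) 𝔄 ι L hL) Kunit inΛ unitDist) :
    N15At { I := VecIndexS d L, c35 := c35, p := p, pi := gaugeVecInstanceM (d := d) 𝔄 ι L hL, Kop := gaugeVecFamilyM4 (d := d) 𝔄 ι e L hL,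
            Ksite := Ksite, Kunit := Kunit, inΛ := inΛ, unitDist := unitDist } :=
  ⟨ne2PlusOperator_vectorPiece_gaugeM4 (d := d) e hd hL c35 hc35, hsite, hunit⟩

end Faces

/-! ## §2 (W2) closers: `S_N15` for every rate-record predicate whose NE2 component IS such a non-abelian family plus the two remaining layers -/

section Closers

/-- **`S_N15` FOR EVERY NON-ABELIAN FIRST-ORDER-BACKGROUND READING** (the carriers of `n15At_vectorPiece_backgroundM₁4_of_layers`): if `RRec` hands, with every
bundle `R` it pins, an identification of `R.ne2` with those carriers (any `c₃₅ > 0`, exponent `p`, site ∕ unit kernels, region, unit distance) together with the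
site-kernel and unit-lattice layers on them, then `S_N15 RRec` — the operator layer is NOT a hypothesis. [bookkeeping] -/
theorem s_N15_of_backgroundM₁4Reading [Nonempty ι] (hd : 1 ≤ d) (hL : 1 ≤ L) (RRec : RateRecordPred N)
    (hread : ∀ (F : T4Family) (D : Datum F N) (g₀ : ℕ → ℝ) (os : List (ULoop F)) (R : RateCarriers N), RRec F D g₀ os R →
      ∃ (c35 p : ℝ) (Ksite Kunit : ∀ j : VecIndexS d L, SiteKernel (bgVecInstanceM₁ (d := d) ι L hL j).gc (bgVecInstanceM₁ (d := d) ι L hL j).Bf)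
        (inΛ : ∀ j : VecIndexS d L, (bgVecInstanceM₁ (d := d) ι L hL j).gc.Site → Prop)
        (unitDist : ∀ j : VecIndexS d L, (bgVecInstanceM₁ (d := d) ι L hL j).gc.Site → (bgVecInstanceM₁ (d := d) ι L hL j).gc.Site → ℝ),
        0 < c35 ∧
        R.ne2 = { I := VecIndexS d L, c35 := c35, p := p, pi := bgVecInstanceM₁ (d := d) ι L hL, Kop := bgVecFamilyM₁4 (d := d) ι L hL,
                  Ksite := Ksite, Kunit := Kunit, inΛ := inΛ, unitDist := unitDist } ∧
        NE2PlusSite 4 p c35 (bgVecInstanceM₁ (d := d) ι L hL) Ksite ∧ NE2PlusUnit c35 (bgVecInstanceM₁ (d := d) ι L hL) Kunit inΛ unitDist) :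
    S_N15 RRec := by
  intro F D g₀ os R hR
  obtain ⟨c35, p, Ksite, Kunit, inΛ, unitDist, hc35, hne2, hsite, hunit⟩ := hread F D g₀ os R hR
  rw [hne2]
  exact n15At_vectorPiece_backgroundM₁4_of_layers hd hL hc35 p Ksite Kunit inΛ unitDist hsite hunit

/-- **`S_N15` FOR EVERY NON-ABELIAN GAUGE-FIELD READING** (the carriers of `n15At_vectorPiece_gaugeM4_of_layers`, coordinates `e`). [bookkeeping] -/
theorem s_N15_of_gaugeM4Reading (hd : 1 ≤ d) (hL : 1 ≤ L) (RRec : RateRecordPred N)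
    (hread : ∀ (F : T4Family) (D : Datum F N) (g₀ : ℕ → ℝ) (os : List (ULoop F)) (R : RateCarriers N), RRec F D g₀ os R →
      ∃ (c35 p : ℝ) (Ksite Kunit : ∀ j : VecIndexS d L, SiteKernel (gaugeVecInstanceM (d := d) 𝔄 ι L hL j).gc (gaugeVecInstanceM (d := d) 𝔄 ι L hL j).Bf)
        (inΛ : ∀ j : VecIndexS d L, (gaugeVecInstanceM (d := d) 𝔄 ι L hL j).gc.Site → Prop)
        (unitDist : ∀ j : VecIndexS d L, (gaugeVecInstanceM (d := d) 𝔄 ι L hL j).gc.Site → (gaugeVecInstanceM (d := d) 𝔄 ι L hL j).gc.Site → ℝ),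
        0 < c35 ∧
        R.ne2 = { I := VecIndexS d L, c35 := c35, p := p, pi := gaugeVecInstanceM (d := d) 𝔄 ι L hL, Kop := gaugeVecFamilyM4 (d := d) 𝔄 ι e L hL,
                  Ksite := Ksite, Kunit := Kunit, inΛ := inΛ, unitDist := unitDist } ∧
        NE2PlusSite 4 p c35 (gaugeVecInstanceM (d := d) 𝔄 ι L hL) Ksite ∧ NE2PlusUnit c35 (gaugeVecInstanceM (d := d) 𝔄 ι L hL) Kunit inΛ unitDist) :
    S_N15 RRec := by
  intro F D g₀ os R hR
  obtain ⟨c35, p, Ksite, Kunit, inΛ, unitDist, hc35, hne2, hsite, hunit⟩ := hread F D g₀ os R hR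
  rw [hne2]
  exact n15At_vectorPiece_gaugeM4_of_layers e hd hL hc35 p Ksite Kunit inΛ unitDist hsite hunit

end Closers

/-! ## §3 Guard: on the gauge-live non-abelian carriers the operator layer is never the reason `N15At` fails -/

section Guard

/-- **ON THE NON-ABELIAN GAUGE-LIVE CARRIERS `N15At` FAILS IFF THE SITE OR THE UNIT LAYER FAILS** (the operator layer holds by
`VectorPiece.ne2PlusOperator_vectorPiece_gaugeM4`): the honest residue of N15 on this family is the pair of displayed layers. [bookkeeping] -/
theorem not_n15At_iff_site_or_unit_fails_gaugeM4 (hd : 1 ≤ d) (hL : 1 ≤ L) {c35 : ℝ} (hc35 : 0 < c35) (p : ℝ)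
    (Ksite Kunit : ∀ j : VecIndexS d L, SiteKernel (gaugeVecInstanceM (d := d) 𝔄 ι L hL j).gc (gaugeVecInstanceM (d := d) 𝔄 ι L hL j).Bf)
    (inΛ : ∀ j : VecIndexS d L, (gaugeVecInstanceM (d := d) 𝔄 ι L hL j).gc.Site → Prop)
    (unitDist : ∀ j : VecIndexS d L, (gaugeVecInstanceM (d := d) 𝔄 ι L hL j).gc.Site → (gaugeVecInstanceM (d := d) 𝔄 ι L hL j).gc.Site → ℝ) :
    ¬ N15At { I := VecIndexS d L, c35 := c35, p := p, pi := gaugeVecInstanceM (d := d) 𝔄 ι L hL, Kop := gaugeVecFamilyM4 (d := d) 𝔄 ι e L hL,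
              Ksite := Ksite, Kunit := Kunit, inΛ := inΛ, unitDist := unitDist } ↔
      ¬ NE2PlusSite 4 p c35 (gaugeVecInstanceM (d := d) 𝔄 ι L hL) Ksite ∨ ¬ NE2PlusUnit c35 (gaugeVecInstanceM (d := d) 𝔄 ι L hL) Kunit inΛ unitDist := by
  constructor
  · intro h
    by_cases hs : NE2PlusSite 4 p c35 (gaugeVecInstanceM (d := d) 𝔄 ι L hL) Ksite
    · by_cases hu : NE2PlusUnit c35 (gaugeVecInstanceM (d := d) 𝔄 ι L hL) Kunit inΛ unitDist
      · exact absurd (n15At_vectorPiece_gaugeM4_of_layers e hd hL hc35 p Ksite Kunit inΛ unitDist hs hu) h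
      · exact Or.inr hu
    · exact Or.inl hs
  · rintro (hs | hu) ⟨_, hsite, hunit⟩
    · exact hs hsite
    · exact hu hunit

end Guard

end Summit.QuantumFields.YangMills.Theorems.N15AtSpineCarriers

end
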